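import Summits.QuantumFields.YangMills.Theorems.BalabanUVNodesK0Stub1FlatChartSlN
import Summits.QuantumFields.YangMills.Theorems.BalabanUVNodesN07DPrimeChartDictionary
import HarnessLib

/-!
# N07 [B11] ∕ K0⁷ road, chart side — MODULE 116: **THE CHART PREIMAGE AT THE RECORD** — print's «we make the change of variables `A = A′ − HD(A′)`» ((159) with (49)–(50)): for every
# admissible family of NODE 00's four-tori and the implicit ♭ chart `Dsel` delivered by the (158) supplier (its (55)♭ and (49)♭ rows on the `ε`-ball), every Hermitian-traceless `A` of
# two-size `≤ r ≤ r₀` has the preimage `A′ := A + H(C A)` with `A′ − H(Dsel A′) = A`, two-size `≤ r + B_q r²`, inside the `ε`-ball, Hermitian-traceless — `r₀ > 0` uniform in the family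

Cell `pub-ymgap`, seat `pub-ymgap-dag-n07-e` g30 (FAN-OUT §N07 row s3; LANE OWNER of the K0 road chart side), MODULE 116 of the (d′)-Lam assembly (`DPRIME-LAM-ROADMAP.md` §3 «chart
parameter», §5 (j); desk HANDOFF § g29 add. 4 «the (50) paragraph»).  `--kind proof --supports stmt-QuantumFields-20541 --as helper` (K0⁷); count-neutral; theorems only.
[15] = [Balaban1985Variational]; [4] = [Balaban1984PropagatorsII].

WHY.  The supplier of the (d′) letter (MODULE 114, S4-Lam) reads the configuration GLOBALLY through the chart, `U₁ = e^{iη(A′₁ − H·Dsel A′₁)}`, and ∃-quantifies the selector `Dsel` with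
its (55)♭ ∕ (49)♭ ∕ (48)♭ ∕ reality rows but NOT the (50) uniqueness row; the assembly needs, for the truncated tower potential `Ã`, a chart parameter `A′` with `A′ − H(Dsel A′) = Ã`.
MODULE 105 §1 (`exists_chart_preimage_of_unique`) builds `A′ := Ã + H(C Ã)` from the row of `H`, the quadratic bound of `C = chartLogFlat − D(chartLogFlat)(0)` and a (50) row for `Dsel`.
This file supplies the (50) row for ANY selector with the (55)♭ + (49)♭ rows, by k0-s1-w4's uniqueness of small solutions of (49)♭ (`K0Stub1FlatChartDImplicit.exists_analytic_chartDFlat`,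
conjunct `huniq`: two small fixed points at one `A′` coincide — §1), and assembles the record edition with k-UNIFORM constants: the sup and gradient rows of the ♭-rescaled `H`
(`K0Stub1FlatHRescaledRowsAtRecord.rescaledRows_of_adm22_T4`), the quadratic bound (`K0Stub1FlatChartRemainderP.chartRemainderFlat_hCd_hCq`), and the reality of `A′`
(`K0Stub1FlatChartSlN.chartLogFlat_mem_herm0_weightedBall_P`, `realKernel_mem`, `K0Stub1FlatChartValued.fderiv_chartLogFlat_zero_mem`) under the winding guard `32ℓL·r₀ < δ_N`.

WHAT IS PROVED (sorry-free; no definition; axioms standard).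
§1 ★ `chartDFlat_unique` (generic torus `P`, level `k`: under the data of `exists_analytic_chartDFlat`, two `D′` with `‖D′ c‖ ≤ 4C₂♭ε²` solving (49)♭ at one point of the `ε`-ball coincide).
§2 ★★★ `exists_chart_preimage_T4` — for `F : T4Family`, `N ≥ 1`: `∃ Mh₀ R₀ B_q ≥ 0, ∀ ε > 0, C₄ ≥ 0, ∃ r₀ > 0` such that at every admissible family (`1 ≤ K − n`, `K − n + 1 ≤ m + K`,
`M_h = L^{a′} ≥ Mh₀`, `R ≥ R₀`, `a′ + 3 ≤ m + n`, `D.k = K − n`, `Adm22 D R (L·M_h)`, the (152) weights), for EVERY ℂ-linear `H` with the ♭-rescaled kernel and EVERY `Dsel` with the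
supplier's (55)♭ row at `(ε, C₄)` and (49)♭∕(48)♭ row on the `ε`-ball, and every bondwise Hermitian-traceless `A` with `w₁‖A‖ ≤ r`, `w₂L^{K−n}‖A(·+e_ν) − A‖ ≤ r`, `0 ≤ r ≤ r₀`:
`∃ Z`, `A′ := A + H Z` has both rows `≤ r + B_q r²`, `r + B_q r² < ε`, `w₁‖A′‖ < ε`, `A′ − H(Dsel A′) = A`, and `A′` is bondwise Hermitian-traceless.
HONEST FRAMING: bookkeeping over k0-s1's kernel-checked chart files, cited by name; NOTHING of [15]'s estimates asserted beyond them; (d′) ∕ `HThm4RecDbar` ∕ budget row of MODULE 100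
untouched; K0⁷ NOT closed; N07 NOT discharged; counts unmoved; one finite 𝕋⁴ programme at fixed ε — NOT continuum ∕ ℝ⁴ ∕ OS ∕ mass gap ∕ Clay.  No `sorry`, no `def`, no `instance`,
no `notation`.

References: [15] (44)–(50) p.285, (55) p.286, Prop. 3 p.289, (152) p.301, (157)–(159) pp.302–303; [4] (2.35) p.228, Cor. 2.8 p.249; [Balaban1987RG1] (0.1) p.251, (0.4) p.253.
-/

set_option autoImplicit false

noncomputable section

open scoped BigOperators Matrix.Norms.L2Operator ContDiff

namespace Summit.QuantumFields.YangMills.BalabanUVNodes.N07DPrimeChartPreimageAtRecord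

open Literature.MathematicalPhysics.QuantumFieldTheory.Balaban1983to89
open Literature.MathematicalPhysics.QuantumFieldTheory.Balaban1983to89.T4Continuum (T4Family)
open ExpMeanLog (deltaSU deltaSU_pos)
open B6SectADomainsV1 (Domains)
open B6SectAOperatorsV1 (BondIdx)
open B9AdOrthogonal (herm0)
open Summit.QuantumFields.YangMills.Theorems.FlatCubeOpsText (Adm22)
open Summit.QuantumFields.YangMills.Theorems.K0FlatCubeOpsTextP (IsLevWeight flatH)
open Summit.QuantumFields.YangMills.Theorems.Prop8Chart (collar_of_adm22)
open Summit.QuantumFields.YangMills.Theorems.Prop8ChartDoubleBar (chartLogFlat)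
open Summit.QuantumFields.YangMills.Theorems.K0Stub1FlatChartDImplicit (exists_analytic_chartDFlat)
open Summit.QuantumFields.YangMills.Theorems.K0Stub1FlatChartRemainderP (chartRemainderFlat_hCd_hCq)
open Summit.QuantumFields.YangMills.Theorems.K0Stub1FlatHRescaledRowsAtRecord (rescaledRows_of_adm22_T4)
open Summit.QuantumFields.YangMills.Theorems.K0Stub1FlatChartValued (fderiv_chartLogFlat_zero_mem)
open Summit.QuantumFields.YangMills.Theorems.K0Stub1FlatChartSlN (chartLogFlat_mem_herm0_weightedBall_P realKernel_mem)
open Summit.QuantumFields.YangMills.BalabanUVNodes.N07DPrimeChartDictionary (exists_chart_preimage_of_unique)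

/-! ## §1  Uniqueness of small solutions of (49)♭ at a point -/

section Unique

variable {P : Params} {N : ℕ} [NeZero N] {k : ℕ} {D : Domains P}

/-- ★ **TWO SMALL SOLUTIONS OF (49)♭ AT ONE POINT COINCIDE** (k0-s1-w4's `exists_analytic_chartDFlat`, conjunct `huniq`, read twice): under that theorem's data — nested `D` (`D.k = k`),
`Adm22 D R′ M` (`2L ≤ R′`, `1 ≤ M`), the (152) weights, a ℂ-linear `H` with the sup (46) row `B₀ ≥ 0`, the window `9C₂♭B₀ε < 1`, `3ε ≤ R⋆♭∕4`, `0 < ε` — at every `A′` of the weighted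
`ε`-ball two `D′` with `‖D′ c‖ ≤ 4C₂♭ε²` and `C♭(A′ − H D′) = D′` are equal.  (The (50) row for ANY selector with the (55)♭ + (49)♭ rows.)
[cite: Balaban1985Variational, (49)–(50) p.285, (55) p.286, Prop. 3 p.289] -/
theorem chartDFlat_unique {R' M : ℕ} (hR'L : 2 * P.L ≤ R') (hM : 1 ≤ M) (hDk : D.k = k) (hAdm : Adm22 D R' M)
    {w : ℕ → PBond P 0 → ℝ} (hw : IsLevWeight P k D w)
    (H : (BondIdx D → Matrix (Fin N) (Fin N) ℂ) →ₗ[ℂ] (PBond P 0 → Matrix (Fin N) (Fin N) ℂ)) {B₀ : ℝ} (hB₀ : 0 ≤ B₀)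
    (hHB : ∀ (X : BondIdx D → Matrix (Fin N) (Fin N) ℂ) (t : ℝ), 0 ≤ t → (∀ c, ‖X c‖ ≤ t) → ∀ b, w 1 b * ‖H X b‖ ≤ B₀ * t)
    {ε : ℝ}
    (hq : 9 * (64 * (P.L : ℝ) / (60800 * (((P.d + 2) * P.L : ℕ) : ℝ) ^ 2 * (P.L : ℝ))⁻¹) * B₀ * ε < 1)
    (h3ε : 3 * ε ≤ (60800 * (((P.d + 2) * P.L : ℕ) : ℝ) ^ 2 * (P.L : ℝ))⁻¹ / 4) (hε : 0 < ε)
    (A' : PBond P 0 → Matrix (Fin N) (Fin N) ℂ) (hA' : ∀ b, w 1 b * ‖A' b‖ < ε)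
    (D₁ D₂ : BondIdx D → Matrix (Fin N) (Fin N) ℂ)
    (hD₁ : ∀ c, ‖D₁ c‖ ≤ 4 * (64 * (P.L : ℝ) / (60800 * (((P.d + 2) * P.L : ℕ) : ℝ) ^ 2 * (P.L : ℝ))⁻¹) * ε ^ 2)
    (hfix₁ : chartLogFlat (((P.L : ℝ)⁻¹) ^ k) D (A' - H D₁) -
      (fderiv ℂ (chartLogFlat (((P.L : ℝ)⁻¹) ^ k) D : (PBond P 0 → Matrix (Fin N) (Fin N) ℂ) → BondIdx D → Matrix (Fin N) (Fin N) ℂ) 0) (A' - H D₁) = D₁)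
    (hD₂ : ∀ c, ‖D₂ c‖ ≤ 4 * (64 * (P.L : ℝ) / (60800 * (((P.d + 2) * P.L : ℕ) : ℝ) ^ 2 * (P.L : ℝ))⁻¹) * ε ^ 2)
    (hfix₂ : chartLogFlat (((P.L : ℝ)⁻¹) ^ k) D (A' - H D₂) -
      (fderiv ℂ (chartLogFlat (((P.L : ℝ)⁻¹) ^ k) D : (PBond P 0 → Matrix (Fin N) (Fin N) ℂ) → BondIdx D → Matrix (Fin N) (Fin N) ℂ) 0) (A' - H D₂) = D₂) :
    D₁ = D₂ := by
  obtain ⟨Dsel, -, -, hspec⟩ := exists_analytic_chartDFlat (k := k) (D := D) hR'L hM hDk hAdm hw H hB₀ hHB hq h3ε hε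
  have huniq := (hspec A' hA').2.2.1
  rw [huniq D₁ hD₁ hfix₁, huniq D₂ hD₂ hfix₂]

end Unique

/-! ## §2  The record edition: the preimage with k-uniform constants, Hermitian-traceless -/

section Record

/-- `min`-arithmetic: a nonnegative number below `min a b` is below both. [folklore] -/
private theorem le_of_le_min₂ {x a b : ℝ} (h : x ≤ min a b) : x ≤ a ∧ x ≤ b := ⟨h.trans (min_le_left _ _), h.trans (min_le_right _ _)⟩

/-- ★★★ **THE CHART PREIMAGE AT THE RECORD, k-UNIFORM** (statement in the header). [cite: Balaban1985Variational, (44)–(50) p.285, (55) p.286, (152) p.301, (157)–(159) pp.302–303; Balaban1984PropagatorsII, (2.35) p.228, Cor. 2.8 p.249] -/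
theorem exists_chart_preimage_T4 (N : ℕ) [NeZero N] (F : T4Family) :
    ∃ (Mh₀ R₀ : ℕ) (Bq : ℝ), 0 ≤ Bq ∧
    ∀ (ε C₄ : ℝ), 0 < ε → 0 ≤ C₄ → ∃ r₀ : ℝ, 0 < r₀ ∧
    ∀ (n K : ℕ) (_ : 1 ≤ K - n) (_ : K - n + 1 ≤ F.m + K) {Mh R a' : ℕ} (_ : Mh = F.L ^ a') (_ : Mh₀ ≤ Mh) (_ : R₀ ≤ R)
      (_ : a' + 3 ≤ F.m + n) (D : Domains (F.P K)) (_ : D.k = K - n) (_ : Adm22 D R (F.L * Mh))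
      (w : ℕ → PBond (F.P K) 0 → ℝ) (_ : IsLevWeight (F.P K) (K - n) D w)
      (H : (BondIdx D → Matrix (Fin N) (Fin N) ℂ) →ₗ[ℂ] (PBond (F.P K) 0 → Matrix (Fin N) (Fin N) ℂ))
      (_ : ∀ (X : BondIdx D → Matrix (Fin N) (Fin N) ℂ) (b : PBond (F.P K) 0), H X b =
        ∑ t, (((((F.P K).L : ℝ) ^ (t.1.1 : ℕ) * ((((F.P K).L : ℝ))⁻¹) ^ (K - n))⁻¹ * flatH (F.P K) (K - n) D (Pi.single t 1) b : ℝ) : ℂ) • X t)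
      (Dsel : (PBond (F.P K) 0 → Matrix (Fin N) (Fin N) ℂ) → (BondIdx D → Matrix (Fin N) (Fin N) ℂ))
      (_ : ∀ A' : PBond (F.P K) 0 → Matrix (Fin N) (Fin N) ℂ, (∀ b, w 1 b * ‖A' b‖ < ε) →
        ∀ ρ' : ℝ, 0 ≤ ρ' → (∀ b, w 1 b * ‖A' b‖ ≤ ρ') → ∀ i : BondIdx D, ‖Dsel A' i‖ ≤ C₄ * ρ' ^ 2)
      (_ : ∀ A' : PBond (F.P K) 0 → Matrix (Fin N) (Fin N) ℂ, (∀ b, w 1 b * ‖A' b‖ < ε) →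
        chartLogFlat (((((F.P K).L : ℝ))⁻¹) ^ (K - n)) D (A' - H (Dsel A')) - (fderiv ℂ (chartLogFlat (((((F.P K).L : ℝ))⁻¹) ^ (K - n)) D :
        (PBond (F.P K) 0 → Matrix (Fin N) (Fin N) ℂ) → BondIdx D → Matrix (Fin N) (Fin N) ℂ) 0) (A' - H (Dsel A')) = Dsel A' ∧
        chartLogFlat (((((F.P K).L : ℝ))⁻¹) ^ (K - n)) D (A' - H (Dsel A')) = (fderiv ℂ (chartLogFlat (((((F.P K).L : ℝ))⁻¹) ^ (K - n)) D :
        (PBond (F.P K) 0 → Matrix (Fin N) (Fin N) ℂ) → BondIdx D → Matrix (Fin N) (Fin N) ℂ) 0) A')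
      (A : PBond (F.P K) 0 → Matrix (Fin N) (Fin N) ℂ) (r : ℝ) (_ : 0 ≤ r) (_ : r ≤ r₀)
      (_ : ∀ b, w 1 b * ‖A b‖ ≤ r) (_ : ∀ (b : PBond (F.P K) 0) (ν : Fin (F.P K).d), w 2 b * ((F.P K).L : ℝ) ^ (K - n) * ‖A ⟨b.src.shift ν, b.dir⟩ - A b‖ ≤ r)
      (_ : ∀ b, A b ∈ herm0 (Fin N)),
    ∃ Z : BondIdx D → Matrix (Fin N) (Fin N) ℂ,
      (∀ b, w 1 b * ‖(A + H Z) b‖ ≤ r + Bq * r ^ 2) ∧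
      (∀ (b : PBond (F.P K) 0) (ν : Fin (F.P K).d), w 2 b * ((F.P K).L : ℝ) ^ (K - n) * ‖(A + H Z) ⟨b.src.shift ν, b.dir⟩ - (A + H Z) b‖ ≤ r + Bq * r ^ 2) ∧
      r + Bq * r ^ 2 < ε ∧ (∀ b, w 1 b * ‖(A + H Z) b‖ < ε) ∧
      (A + H Z) - H (Dsel (A + H Z)) = A ∧
      (∀ b, (A + H Z) b ∈ herm0 (Fin N)) := by
  classical
  -- FILE 10: the sup and gradient rows of every ♭-rescaled `H`
  obtain ⟨Mh₁, R₁, Bf, hBf, hrows⟩ := rescaledRows_of_adm22_T4 F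
  -- the k-uniform constants `R⋆♭`, `C₂♭`, the (49)♭ uniqueness window `ε_u`, the herm0 radius `Rh`
  have hL1 : (1 : ℝ) ≤ F.L := by exact_mod_cast F.hL.2.le
  have hL0 : (0 : ℝ) < F.L := by positivity
  set ℓ : ℝ := ((((4 : ℕ) + 2) * F.L : ℕ) : ℝ) with hℓ
  have hℓ1 : (1 : ℝ) ≤ ℓ := by rw [hℓ]; exact_mod_cast Nat.one_le_iff_ne_zero.mpr (Nat.mul_ne_zero (by omega) (by have := F.hL.2; omega))
  have hℓ0 : 0 < ℓ := by positivity
  set Rs : ℝ := (60800 * ℓ ^ 2 * (F.L : ℝ))⁻¹ with hRs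
  have hden : 0 < 60800 * ℓ ^ 2 * (F.L : ℝ) := by positivity
  have hRs0 : 0 < Rs := inv_pos.mpr hden
  set C₂ : ℝ := 64 * (F.L : ℝ) / Rs with hC₂
  have hC₂0 : 0 < C₂ := div_pos (by positivity) hRs0
  set Rh : ℝ := min (1 / (16 * 3800 * ℓ ^ 2 * (F.L : ℝ))) (deltaSU (Fin N) / (32 * ℓ * (F.L : ℝ))) with hRh
  have hδ := deltaSU_pos (n := Fin N)
  have hRh0 : 0 < Rh := lt_min (by positivity) (by positivity)
  refine ⟨Mh₁, max R₁ (2 * F.L), Bf * C₂, mul_nonneg hBf hC₂0.le, ?_⟩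
  intro ε C₄ hε hC₄
  -- the uniqueness window `ε_u ≤ ε` and the small radius `ε_s` where (50) transfers to `Dsel`
  set εu : ℝ := min ε (min (Rs / 12) (1 / (9 * C₂ * Bf + 1))) with hεu
  have hεu0 : 0 < εu := lt_min hε (lt_min (by positivity) (by positivity))
  have hεuε : εu ≤ ε := min_le_left _ _
  have hεuR : 3 * εu ≤ Rs / 4 := by
    have h : εu ≤ Rs / 12 := (min_le_right _ _).trans (min_le_left _ _)
    linarith only [h]
  have hεuq : 9 * C₂ * Bf * εu < 1 := by
    have h1 : εu ≤ 1 / (9 * C₂ * Bf + 1) := (min_le_right _ _).trans (min_le_right _ _)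
    have h2 : 0 ≤ 9 * C₂ * Bf := by positivity
    calc 9 * C₂ * Bf * εu ≤ 9 * C₂ * Bf * (1 / (9 * C₂ * Bf + 1)) := mul_le_mul_of_nonneg_left h1 h2
      _ < 1 := by rw [mul_one_div, div_lt_one (by positivity)]; exact lt_add_one _
  set τ : ℝ := min 1 (4 * C₂ / (C₄ + 1)) with hτ
  have hτ0 : 0 < τ := lt_min one_pos (by positivity)
  have hτ1 : τ ≤ 1 := min_le_left _ _
  set εs : ℝ := εu * τ with hεs
  have hεs0 : 0 < εs := mul_pos hεu0 hτ0
  have hεsu : εs ≤ εu := by rw [hεs]; exact mul_le_of_le_one_right hεu0.le hτ1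
  -- `C₄·εs² ≤ 4C₂·εu²`
  have hC₄εs : C₄ * εs ^ 2 ≤ 4 * C₂ * εu ^ 2 := by
    have h1 : C₄ * εs ^ 2 ≤ (C₄ + 1) * εs ^ 2 := mul_le_mul_of_nonneg_right (le_add_of_nonneg_right zero_le_one) (sq_nonneg _)
    have h2 : (C₄ + 1) * εs ^ 2 = (C₄ + 1) * τ * (εu ^ 2 * τ) := by rw [hεs]; ring
    have h3 : (C₄ + 1) * τ ≤ 4 * C₂ := by
      have := min_le_right 1 (4 * C₂ / (C₄ + 1))
      rw [← hτ] at this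
      have h := mul_le_mul_of_nonneg_left this (by positivity : (0 : ℝ) ≤ C₄ + 1)
      rwa [mul_div_cancel₀ _ (by positivity : (C₄ + 1 : ℝ) ≠ 0)] at h
    have h4 : εu ^ 2 * τ ≤ εu ^ 2 := mul_le_of_le_one_right (sq_nonneg _) hτ1
    calc C₄ * εs ^ 2 ≤ (C₄ + 1) * τ * (εu ^ 2 * τ) := by rw [← h2]; exact h1
      _ ≤ 4 * C₂ * εu ^ 2 := mul_le_mul h3 h4 (by positivity) (by positivity)
  -- the radius `r₀`
  set r₀ : ℝ := min (εs / 2) (min (Rs / 8) (min (1 / (2 * (Bf * C₂) + 1)) (Rh / 2))) with hr₀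
  have hr₀0 : 0 < r₀ := lt_min (by positivity) (lt_min (by positivity) (lt_min (by positivity) (by positivity)))
  refine ⟨r₀, hr₀0, ?_⟩
  intro n K hk1 hk' Mh R a' hMha hMh hR hsize D hDk hAdm w hw H hH Dsel h55 hfix A r hr0 hrr₀ hA1 hA2 hAh
  have hR₁ : R₁ ≤ R := (le_max_left _ _).trans hR
  have hR'L : 2 * (F.P K).L ≤ R := (le_max_right _ _).trans hR
  have hM : 1 ≤ F.L * Mh := by
    rw [hMha]; exact Nat.one_le_iff_ne_zero.mpr (Nat.mul_ne_zero (by have := F.hL11; omega) (pow_ne_zero _ (by have := F.hL11; omega)))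
  -- the carrier's letters: `(F.P K).d = 4`, `(F.P K).L = F.L`
  have hPd : (F.P K).d = 4 := rfl
  have hPL : (F.P K).L = F.L := rfl
  have hℓP : ((((F.P K).d + 2) * (F.P K).L : ℕ) : ℝ) = ℓ := by rw [hPd, hPL]
  have hRsP : (60800 * ((((F.P K).d + 2) * (F.P K).L : ℕ) : ℝ) ^ 2 * ((F.P K).L : ℝ))⁻¹ = Rs := by rw [hℓP, hPL]
  have hC₂P : 64 * ((F.P K).L : ℝ) / (60800 * ((((F.P K).d + 2) * (F.P K).L : ℕ) : ℝ) ^ 2 * ((F.P K).L : ℝ))⁻¹ = C₂ := by rw [hRsP, hPL]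
  have hw1pos : ∀ b : PBond (F.P K) 0, 0 < w 1 b := fun b => by rw [hw 1 b, pow_one]; positivity
  -- radius bookkeeping
  have hr1 : r ≤ εs / 2 := hrr₀.trans (min_le_left _ _)
  have hr2 : r ≤ Rs / 8 := hrr₀.trans ((min_le_right _ _).trans (min_le_left _ _))
  have hr3 : r ≤ 1 / (2 * (Bf * C₂) + 1) := hrr₀.trans ((min_le_right _ _).trans ((min_le_right _ _).trans (min_le_left _ _)))
  have hr4 : r ≤ Rh / 2 := hrr₀.trans ((min_le_right _ _).trans ((min_le_right _ _).trans (min_le_right _ _)))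
  have hrR : r < Rs / 4 := by linarith only [hr2, hRs0]
  have hBCr : Bf * C₂ * r ≤ 1 / 2 := by
    have h0 : 0 ≤ Bf * C₂ := by positivity
    calc Bf * C₂ * r ≤ Bf * C₂ * (1 / (2 * (Bf * C₂) + 1)) := mul_le_mul_of_nonneg_left hr3 h0
      _ ≤ 1 / 2 := by rw [mul_one_div, div_le_iff₀ (by positivity)]; linarith only [h0]
  have hsum : r + Bf * (C₂ * r ^ 2) < εs := by
    have h1 : Bf * (C₂ * r ^ 2) = (Bf * C₂ * r) * r := by ring
    have h2 : Bf * (C₂ * r ^ 2) ≤ 1 / 2 * r := by rw [h1]; exact mul_le_mul_of_nonneg_right hBCr hr0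
    linarith only [h2, hr1, hεs0, hr0]
  have hsum' : r + Bf * C₂ * r ^ 2 < ε := by
    have : Bf * C₂ * r ^ 2 = Bf * (C₂ * r ^ 2) := by ring
    rw [this]; linarith only [hsum, hεsu, hεuε]
  have h4 : C₂ * r ^ 2 ≤ 4 * C₂ * εs ^ 2 := by
    have h1 : r ^ 2 ≤ εs ^ 2 := pow_le_pow_left₀ hr0 (by linarith) 2
    have h2 : C₂ * r ^ 2 ≤ C₂ * εs ^ 2 := mul_le_mul_of_nonneg_left h1 hC₂0.le
    have h3 : 0 ≤ C₂ * εs ^ 2 := by positivity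
    have h4' : 4 * C₂ * εs ^ 2 = 4 * (C₂ * εs ^ 2) := by ring
    rw [h4']; linarith only [h2, h3]
  have hC₂r : 0 ≤ C₂ * r ^ 2 := by positivity
  clear_value εu τ εs r₀
  -- the rows of `H`: sup and gradient (`|ν t| ≤ (L^{lev t}·η)⁻¹` with equality)
  have hν : ∀ t : BondIdx D, |((((F.P K).L : ℝ) ^ (t.1.1 : ℕ) * ((((F.P K).L : ℝ))⁻¹) ^ (K - n))⁻¹)| ≤
      (((F.P K).L : ℝ) ^ (t.1.1 : ℕ) * ((((F.P K).L : ℝ))⁻¹) ^ (K - n))⁻¹ := fun t => le_of_eq (abs_of_nonneg (by rw [hPL]; positivity))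
  obtain ⟨hHB, hHG⟩ := hrows n K hk1 hk' hMha hMh hR₁ hsize D hDk hAdm w hw (𝔸 := Matrix (Fin N) (Fin N) ℂ) _ hν H hH
  -- the quadratic bound of `C♭` on the ball `R⋆♭∕4`
  obtain ⟨-, hquad⟩ := chartRemainderFlat_hCd_hCq (𝔸 := Matrix (Fin N) (Fin N) ℂ) (K - n) hR'L hM D hDk hAdm hw
  rw [hRsP] at hquad
  -- the letter `C♭ := chartLogFlat − Qlin♭`
  set η : ℝ := ((((F.P K).L : ℝ))⁻¹) ^ (K - n) with hη
  set Qlin := (fderiv ℂ (chartLogFlat η D : (PBond (F.P K) 0 → Matrix (Fin N) (Fin N) ℂ) → BondIdx D → Matrix (Fin N) (Fin N) ℂ) 0) with hQlin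
  obtain ⟨C, hCdef⟩ : ∃ C : (PBond (F.P K) 0 → Matrix (Fin N) (Fin N) ℂ) → (BondIdx D → Matrix (Fin N) (Fin N) ℂ),
      ∀ Y, C Y = chartLogFlat η D Y - Qlin Y := ⟨_, fun _ => rfl⟩
  have hCq : ∀ (Y : PBond (F.P K) 0 → Matrix (Fin N) (Fin N) ℂ) (r' : ℝ), r' < Rs / 4 → (∀ b, w 1 b * ‖Y b‖ ≤ r') →
      ∀ c : BondIdx D, (fun _ : BondIdx D => (1 : ℝ)) c * ‖C Y c‖ ≤ C₂ * r' ^ 2 := by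
    intro Y r' hr' hY c
    rw [one_mul, hCdef, Pi.sub_apply]
    exact hquad Y r' hr' hY c
  have hHw : ∀ (X : BondIdx D → Matrix (Fin N) (Fin N) ℂ) (t : ℝ), 0 ≤ t → (∀ c, (fun _ : BondIdx D => (1 : ℝ)) c * ‖X c‖ ≤ t) →
      ∀ b, w 1 b * ‖H X b‖ ≤ Bf * t := fun X t ht hX b => hHB X t ht (fun c => by simpa only [one_mul] using hX c) b
  -- ★ the (50) row for `Dsel` at radius `εs`
  have h50 : ∀ A' : PBond (F.P K) 0 → Matrix (Fin N) (Fin N) ℂ, (∀ b, w 1 b * ‖A' b‖ < εs) →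
      ∀ D' : BondIdx D → Matrix (Fin N) (Fin N) ℂ, (∀ c, (fun _ : BondIdx D => (1 : ℝ)) c * ‖D' c‖ ≤ 4 * C₂ * εs ^ 2) → C (A' - H D') = D' → D' = Dsel A' := by
    intro A' hA' D' hD' hD'fix
    have hA'u : ∀ b, w 1 b * ‖A' b‖ < εu := fun b => (hA' b).trans_le hεsu
    have hA'ε : ∀ b, w 1 b * ‖A' b‖ < ε := fun b => (hA'u b).trans_le hεuε
    have hεsu2 : 4 * C₂ * εs ^ 2 ≤ 4 * C₂ * εu ^ 2 := by
      have : εs ^ 2 ≤ εu ^ 2 := pow_le_pow_left₀ hεs0.le hεsu 2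
      exact mul_le_mul_of_nonneg_left this (by positivity)
    have hq' : 9 * (64 * ((F.P K).L : ℝ) / (60800 * ((((F.P K).d + 2) * (F.P K).L : ℕ) : ℝ) ^ 2 * ((F.P K).L : ℝ))⁻¹) * Bf * εu < 1 := by rw [hC₂P]; exact hεuq
    have h3' : 3 * εu ≤ (60800 * ((((F.P K).d + 2) * (F.P K).L : ℕ) : ℝ) ^ 2 * ((F.P K).L : ℝ))⁻¹ / 4 := by rw [hRsP]; exact hεuR
    have e1 : chartLogFlat η D (A' - H D') - Qlin (A' - H D') = D' := by rw [← hCdef]; exact hD'fix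
    have e2 : chartLogFlat η D (A' - H (Dsel A')) - Qlin (A' - H (Dsel A')) = Dsel A' := (hfix A' hA'ε).1
    have hD's : ∀ c, ‖D' c‖ ≤ 4 * (64 * ((F.P K).L : ℝ) / (60800 * ((((F.P K).d + 2) * (F.P K).L : ℕ) : ℝ) ^ 2 * ((F.P K).L : ℝ))⁻¹) * εu ^ 2 := by
      intro c; rw [hC₂P]; have := hD' c; rw [one_mul] at this; exact this.trans hεsu2
    have hDsels : ∀ c, ‖Dsel A' c‖ ≤ 4 * (64 * ((F.P K).L : ℝ) / (60800 * ((((F.P K).d + 2) * (F.P K).L : ℕ) : ℝ) ^ 2 * ((F.P K).L : ℝ))⁻¹) * εu ^ 2 := by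
      intro c; rw [hC₂P]; exact (h55 A' hA'ε εs hεs0.le (fun b => (hA' b).le) c).trans hC₄εs
    exact chartDFlat_unique hR'L hM hDk hAdm hw H hBf hHB hq' h3' hεu0 A' hA'u D' (Dsel A') hD's e1 hDsels e2
  -- ★ MODULE 105 §1: the preimage `A′ := A + H(C A)`
  obtain ⟨hball, -, hpre⟩ := exists_chart_preimage_of_unique (ι := PBond (F.P K) 0) (β := BondIdx D) (V := Matrix (Fin N) (Fin N) ℂ)
    (w₀ := w 1) (wB := fun _ : BondIdx D => (1 : ℝ)) hw1pos C H Dsel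
    (C₂ := C₂) (R := Rs / 4) (B₀ := Bf) (ε := εs) (ε' := r) hHw hCq h50 hrR hsum h4 hC₂r hA1
  refine ⟨C A, ?_, ?_, hsum', fun b => (hball b).trans_le (hεsu.trans hεuε), hpre, ?_⟩
  · -- sup row of `A′`
    intro b
    have hCA : ∀ c, ‖C A c‖ ≤ C₂ * r ^ 2 := fun c => by simpa only [one_mul] using hCq A r hrR hA1 c
    have hHCA := hHB (C A) _ (by positivity) hCA b
    calc w 1 b * ‖(A + H (C A)) b‖ ≤ w 1 b * ‖A b‖ + w 1 b * ‖H (C A) b‖ := by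
          rw [Pi.add_apply, ← mul_add]; exact mul_le_mul_of_nonneg_left (norm_add_le _ _) (hw1pos b).le
      _ ≤ r + Bf * C₂ * r ^ 2 := by linarith only [hA1 b, hHCA]
  · -- gradient row of `A′`
    intro b ν
    have hCA : ∀ c, ‖C A c‖ ≤ C₂ * r ^ 2 := fun c => by simpa only [one_mul] using hCq A r hrR hA1 c
    have hHCA := hHG (C A) _ (by positivity) hCA b ν
    have hw2 : 0 ≤ w 2 b * ((F.P K).L : ℝ) ^ (K - n) := by rw [hw 2 b]; positivity
    have hsplit : (A + H (C A)) ⟨b.src.shift ν, b.dir⟩ - (A + H (C A)) b = (A ⟨b.src.shift ν, b.dir⟩ - A b) + (H (C A) ⟨b.src.shift ν, b.dir⟩ - H (C A) b) := by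
      simp only [Pi.add_apply]; abel
    calc w 2 b * ((F.P K).L : ℝ) ^ (K - n) * ‖(A + H (C A)) ⟨b.src.shift ν, b.dir⟩ - (A + H (C A)) b‖
        ≤ w 2 b * ((F.P K).L : ℝ) ^ (K - n) * (‖A ⟨b.src.shift ν, b.dir⟩ - A b‖ + ‖H (C A) ⟨b.src.shift ν, b.dir⟩ - H (C A) b‖) := by
          rw [hsplit]; exact mul_le_mul_of_nonneg_left (norm_add_le _ _) hw2
      _ ≤ r + Bf * C₂ * r ^ 2 := by rw [mul_add]; linarith only [hA2 b ν, hHCA]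
  · -- reality of `A′`: `C A ∈ herm0` (SlN §2 at radius `Rh` + `Qlin` preserves), `H` has a real kernel
    have hRM : 2 * (F.P K).L ≤ R * (F.L * Mh) + 1 := by have : R ≤ R * (F.L * Mh) := Nat.le_mul_of_pos_right R hM; omega
    have hcollar := collar_of_adm22 D hAdm hRM
    have hRh1 : 16 * 3800 * ((((F.P K).d + 2) * (F.P K).L : ℕ) : ℝ) ^ 2 * ((F.P K).L : ℝ) * Rh ≤ 1 := by
      rw [hℓP, hPL]
      calc 16 * 3800 * ℓ ^ 2 * (F.L : ℝ) * Rh ≤ 16 * 3800 * ℓ ^ 2 * (F.L : ℝ) * (1 / (16 * 3800 * ℓ ^ 2 * (F.L : ℝ))) :=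
            mul_le_mul_of_nonneg_left (min_le_left _ _) (by positivity)
        _ = 1 := by rw [mul_one_div, div_self (by positivity)]
    have hθ : 16 * ((((F.P K).d + 2) * (F.P K).L : ℕ) : ℝ) * ((F.P K).L : ℝ) * Rh < deltaSU (Fin N) := by
      rw [hℓP, hPL]
      calc 16 * ℓ * (F.L : ℝ) * Rh ≤ 16 * ℓ * (F.L : ℝ) * (deltaSU (Fin N) / (32 * ℓ * (F.L : ℝ))) :=
            mul_le_mul_of_nonneg_left (min_le_right _ _) (by positivity)
        _ = deltaSU (Fin N) / 2 := by field_simp; ring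
        _ < deltaSU (Fin N) := half_lt_self hδ
    have hAR : ∀ b, w 1 b * ‖A b‖ < Rh := fun b => by linarith only [hA1 b, hr4, hRh0]
    have hCAh : ∀ i, C A i ∈ herm0 (Fin N) := fun i => by
      rw [hCdef, Pi.sub_apply]
      exact (herm0 (Fin N)).sub_mem (chartLogFlat_mem_herm0_weightedBall_P (K - n) D hDk hcollar hw hRh1 hθ le_rfl hAR hAh i)
        (fderiv_chartLogFlat_zero_mem _ D (herm0 (Fin N)) hAh i)
    intro b
    rw [Pi.add_apply]
    refine (herm0 (Fin N)).add_mem (hAh b) ?_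
    exact realKernel_mem (herm0 (Fin N)) (fun X => H X)
      (fun b t => (((F.P K).L : ℝ) ^ (t.1.1 : ℕ) * ((((F.P K).L : ℝ))⁻¹) ^ (K - n))⁻¹ * flatH (F.P K) (K - n) D (Pi.single t 1) b) hH hCAh b

end Record

end Summit.QuantumFields.YangMills.BalabanUVNodes.N07DPrimeChartPreimageAtRecord

end
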